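import Literature.AlgebraicGeometry.HodgeTheory.FermatEvenMiddleBettiNumber
import HarnessLib

/-!
# The character eigenspaces `V(α)`, `α ∈ 𝔄²ᵖ⁺¹ₘ`, of `H²ᵖ⁺¹(X²ᵖ⁺¹ₘ(ℂ); ℂ)` are non-zero (Shioda 1979 §1; Ran 1980 Prop. 1.7 (i), existence half, ODD dimension)

Family `hodge`, layer `Literature/AlgebraicGeometry/HodgeTheory`. PROOF FILE (theorems only: no definition, no named
fact, no instance; D-0026 net debt `0`). T. Shioda, *The Hodge conjecture for Fermat varieties*, Math. Ann. 245
(1979), §1 (1.3)–(1.4): "`Hⁿ_prim(Xⁿₘ, ℂ) = ⊕_{α ∈ 𝔄ⁿₘ} V(α)`, `dim V(α) = 1`", `𝔄ⁿₘ = {(a₀, …, aₙ₊₁) : aᵢ ∈ ℤ/m ∖ 0,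
Σ aᵢ = 0}`; Z. Ran, *Cycles on Fermat hypersurfaces*, Compositio Math. 42 (1980), §1 Prop. 1.7 (i). The tree proved
the even-dimensional existence half `V(α) ≠ 0` (`fermatEigenspace_ne_bot`, file `FermatEigenspaceNonvanishing`) and,
in odd dimension, only the upper bound `b₂ₚ₊₁(X²ᵖ⁺¹ₘ) ≤ |𝔄|` (`finrank_complexBetti_fermat_odd_le`). This file proves
the ODD-dimensional existence half **`V(α) ≠ 0` for every `α ∈ 𝔄²ᵖ⁺¹ₘ`, `p, m ≥ 1`** by the same Pham / Ran count,
with ONE sharpening.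

In the count of `fermatEigenspace_ne_bot_of_bounds` the kernel `K` of `i_* : Hₙ(U_k(ℂ)) → Hₙ(X(ℂ))` (`X = Xⁿₘ`,
`U_k = X ∖ Z_k` the affine piece off the coordinate hyperplane section `Z_k ≅ Xⁿ⁻¹ₘ`) is bounded by
`dim H_{n+1}(X(ℂ), U_k(ℂ)) = dim H^{n−1}(Z_k(ℂ))`; for odd `n` the section is even-dimensional and
`b_{n−1}(Z_k) = |𝔄ⁿ⁻¹ₘ| + 1` carries the extra ambient class — one too many for the count. The missing unit is
recovered from the long exact sequence of the pair (Hatcher Thm. 2.16): `H_{n+1}(U_k(ℂ)) = 0`, because the affine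
Fermat variety has the homotopy type of the join of `n + 1` finite sets, whose homology is concentrated in degrees `0`
and `n` (Pham 1965, Milnor §9 — the tree's `joinHomotopyEquivFibre`, `isZero_singularHomology_join`); hence
`H_{n+1}(X(ℂ)) ↪ H_{n+1}(X(ℂ), U_k(ℂ))` and `dim K = b_{n−1}(Z_k) − b_{n+1}(X) ≤ |𝔄ⁿ⁻¹ₘ|`
(`b_{n+1}(Xⁿₘ) ≥ 1`: the ambient class `ι^*h^{(n+1)/2} ≠ 0`).

* `relativeSingularHomology.finrank_ker_map_add_finrank_eq` — on a closed oriented manifold: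
  `dim ker (H_q(X ∖ K) → H_q(X)) + dim H_{q+1}(X) = dim Hᵖ(K)` when `H_{q+1}(X ∖ K) = 0`, `p + q + 1 = dim X`.
* `isZero_singularHomology_complexPointsCompl_fermat` — `H_b(U_k(ℂ); R) = 0` for `b ≠ 0, n`.
* `fermatEigenspace_ne_bot_of_bounds_add` — the count of `fermatEigenspace_ne_bot_of_bounds` with hypothesis (H2)
  weakened to `dim Hᴺ(Xᴺₘ) ≤ #{γ} + dim H_{N+2}(Xᴺ⁺¹ₘ(ℂ))`.
* `one_le_finrank_singularHomology_fermat_odd` — `b₂ₚ₊₂(X²ᵖ⁺¹ₘ) ≥ 1` (in homology over `ℂ`).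
* **`fermatEigenspace_ne_bot_odd`** — `V(α) ≠ 0` for admissible `α` in `H²ᵖ⁺¹(X²ᵖ⁺¹ₘ(ℂ); ℂ)`, `p, m ≥ 1`.
-- TODO(general form): `p = 0` (the Fermat curve; `b₁ = (m−1)(m−2)` is the tree's plane-curve genus file).

The companion `FermatOddMiddleBettiNumber` turns this into `b₂ₚ₊₁(X²ᵖ⁺¹ₘ) = |𝔄|` and `b₂ₚ₊₁(X_F) = |𝔄|` for every
smooth odd-dimensional hypersurface. Written by the prover seat `hodge-nonav-19716-p2` (g5, cell `hodge-nonav`) as step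
F1 of the discharge, modulo the geometric genus, of the binder hV
(`voisin2003_finrank_eigenspace_inf_hodgePiece_of_diagonalStabilizer`) of crux K1-B `VeryGeneralSignCommutatorsInHg`
(route `HodgeConjecture/SignSymmetricPowers`): the `±`-parts of `b₃` of the sign-symmetric threefold are read off at the
Fermat threefold, which needs every admissible `V(α) ⊆ H³(X³_d(ℂ); ℂ)` to be a line.

## References

* [Shioda1979HodgeFermat] T. Shioda, The Hodge conjecture for Fermat varieties, Math. Ann. 245 (1979) 175–184, §1 (1.3)–(1.4).
* [Ran1980] Z. Ran, Cycles on Fermat hypersurfaces, Compositio Math. 42 (1980) 121–142, §1 Lemma 1.4, (1.5), Prop. 1.7 (i).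
* [Milnor1968] J. Milnor, Singular Points of Complex Hypersurfaces, Ann. of Math. Studies 61 (1968), §9 Thm. 9.1, Lemma 9.2.
* [Pham1965] F. Pham, Formules de Picard–Lefschetz généralisées et ramification des intégrales, Bull. SMF 93 (1965), §1.
* [HatcherAT2002] A. Hatcher, Algebraic Topology, CUP 2002, Thm. 2.16, §3.1 Thm. 3.2, §3.3 Prop. 3.46.
* [VoisinHodgeII2003] C. Voisin, Hodge Theory and Complex Algebraic Geometry II (2003), §1.2.3 Cor. 1.25.
-/

noncomputable section

open CategoryTheory CategoryTheory.Limits AlgebraicGeometry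

/-! ### Long exact sequence bookkeeping: the kernel of `H_q(X ∖ K) → H_q(X)` when `H_{q+1}(X ∖ K) = 0` -/

namespace Literature.AlgebraicTopology.SingularHomology

universe u v

/-- **`dim ker (H_q(X ∖ K; F) → H_q(X; F)) + dim H_{q+1}(X; F) = dim Hᵖ(K; F)` when `H_{q+1}(X ∖ K; F) = 0`**
(`X` a closed `F`-oriented `n`-manifold, `K` closed and taut, `p + q + 1 = n`, `Hᵖ(K; F)` finite-dimensional):
in the long exact sequence `H_{q+1}(X ∖ K) → H_{q+1}(X) → H_{q+1}(X, X ∖ K) → H_q(X ∖ K) → H_q(X)` (Hatcher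
Thm. 2.16) the first group vanishes, so `H_{q+1}(X) ↪ H_{q+1}(X, X ∖ K) ≅ Hᵖ(K)` (Alexander–Lefschetz duality,
`relativeSingularHomology.finite_and_finrank_eq_of_retractionNhds`) and the kernel is the image of the boundary.
[cite: HatcherAT2002, Thm. 2.16 and §3.3 Prop. 3.46] -/
theorem relativeSingularHomology.finrank_ker_map_add_finrank_eq {F : Type v} [Field F] {n : ℕ} {X : Type u}
    [TopologicalSpace X] [T2Space X] [CompactSpace X] [ChartedSpace (EuclideanSpace ℝ (Fin n)) X]
    (μ : HomologicalOrientation F X n) {K : Set X} (hK : IsClosed K) (T : Cech.RetractionNhds K)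
    {p q : ℕ} (h : p + (q + 1) = n) [Module.Finite F (singularCohomology F F (↥K) p)]
    (hU : IsZero (singularHomology F F (↥Kᶜ) (q + 1))) :
    (LinearMap.ker (singularHomology.map F F
        (⟨Subtype.val, continuous_subtype_val⟩ : C(↥Kᶜ, X)) q).hom).FG ∧
      Module.finrank F (LinearMap.ker (singularHomology.map F F
          (⟨Subtype.val, continuous_subtype_val⟩ : C(↥Kᶜ, X)) q).hom) +
        Module.finrank F (singularHomology F F X (q + 1)) =
        Module.finrank F (singularCohomology F F (↥K) p) := by
  obtain ⟨hfin, hrank⟩ := relativeSingularHomology.finite_and_finrank_eq_of_retractionNhds μ hK T h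
  haveI := hfin
  -- `ker i_q = range ∂`
  rw [relativeSingularHomology.ker_map_eq_range_δ, ← hrank]
  refine ⟨Module.Finite.iff_fg.mp (Module.Finite.range (relativeSingularHomology.δ F F X Kᶜ q).hom), ?_⟩
  -- `ker ∂ = range j`, `j : H_{q+1}(X) → H_{q+1}(X, X ∖ K)` injective since `H_{q+1}(X ∖ K) = 0`
  have hex₃ := relativeSingularHomology.exact_ofAbsolute_δ F F (X := X) Kᶜ q
  have hex₂ := relativeSingularHomology.exact_map_ofAbsolute F F (X := X) Kᶜ (q + 1)
  rw [ShortComplex.moduleCat_exact_iff_range_eq_ker] at hex₃ hex₂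
  have h0 : singularHomology.map F F (⟨Subtype.val, continuous_subtype_val⟩ : C(↥Kᶜ, X)) (q + 1) = 0 :=
    hU.eq_of_src _ _
  have hinj : Function.Injective (relativeSingularHomology.ofAbsolute F F X Kᶜ (q + 1)).hom := by
    rw [← LinearMap.ker_eq_bot, ← hex₂, LinearMap.range_eq_bot]
    change (singularHomology.map F F (⟨Subtype.val, continuous_subtype_val⟩ : C(↥Kᶜ, X)) (q + 1)).hom = 0
    rw [h0, ModuleCat.hom_zero]
  have hrn := LinearMap.finrank_range_add_finrank_ker (relativeSingularHomology.δ F F X Kᶜ q).hom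
  rw [← hex₃, LinearMap.finrank_range_of_inj hinj] at hrn
  exact hrn

end Literature.AlgebraicTopology.SingularHomology

namespace Literature.AlgebraicGeometry.HodgeTheory

open Literature.AlgebraicGeometry.Motives Literature.AlgebraicTopology.SingularHomology
open Literature.Geometry.ComplexAnalytic Literature.Geometry.ComplexAnalytic.PhamBrieskorn

variable {N m : ℕ}

/-! ### The affine Fermat variety has no homology in degree `n + 1` -/

/-- **`H_b(U_k(ℂ); R) = 0` for `b ≠ 0, n`**, `U_k = Xⁿₘ ∖ Z_k` the affine piece of the Fermat variety (`m ≥ 1`):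
`U_k(ℂ)` is homeomorphic to the Pham–Brieskorn fibre `{Σ zⱼᵐ = 1} ⊂ ℂⁿ⁺¹` (`fermatFibreHomeomorph`), which
deformation-retracts onto the join `J` of `n + 1` copies of `μₘ` (`joinHomotopyEquivFibre`), and `H̃_b(J) = 0` off
degree `n` (`isZero_singularHomology_join`). [cite: Milnor1968, §9 Lemma 9.2 and p. 77] [cite: Pham1965, §1] -/
theorem isZero_singularHomology_complexPointsCompl_fermat (R : Type) [CommRing R] {n : ℕ} (hm : m ≠ 0)
    (k : Fin (n + 2)) {b : ℕ} (hb0 : b ≠ 0) (hbn : b ≠ n) :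
    IsZero (singularHomology R R
      (complexPointsCompl (fermatHypersurface n m) (fermatCoordHyperplane n m k)) b) := by
  have ha : ∀ i : Fin (n + 1), (fun _ : Fin (n + 1) ↦ m) i ≠ 0 := fun _ ↦ hm
  have hJ : IsZero (singularHomology R R (join (fun _ : Fin (n + 1) ↦ m)) b) :=
    isZero_singularHomology_join R ha hb0 hbn
  have e₁ := singularHomology.isoOfHomotopyEquiv R R (joinHomotopyEquivFibre (fun _ : Fin (n + 1) ↦ m) ha) b
  have e₂ := singularHomology.mapIso R R (fermatFibreHomeomorph hm k) b
  exact hJ.of_iso (e₂ ≪≫ e₁.symm)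

/-! ### The count, with the kernel bound sharpened by `b_{N+2}(Xᴺ⁺¹ₘ)` -/

/-- **The dimension count of `fermatEigenspace_ne_bot_of_bounds`, sharpened.** Let `X = Xᴺ⁺¹ₘ` (`N, m ≥ 1`), `k` a
coordinate, and suppose
(H1) `V(β) ⊆ Hᴺ⁺¹(X(ℂ); ℂ)` vanishes for every `β ≠ 0` with `β_k = 0`;
(H2⁺) `dim Hᴺ(Xᴺₘ(ℂ); ℂ) ≤ #{γ ∈ (ℤ/m)ᴺ⁺² : all γⱼ ≠ 0, Σ γⱼ = 0} + dim H_{N+2}(X(ℂ); ℂ)`.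
Then `V(α) ≠ 0` for every `α` with all `αᵢ ≠ 0` and `Σ αᵢ = 0`. The proof is that of
`fermatEigenspace_ne_bot_of_bounds` verbatim (Pham eigenvectors `E_γ ∈ H_{N+1}(U_k(ℂ))`, linearly independent; those with
`Σ γⱼ = 0` die in `H_{N+1}(X(ℂ))` by (H1) and span the kernel `K` of `i_*`; the eigenvector of `γ = (αᵢ)_{i ≠ k}` is not
in `K`, and `i_* E_γ ≠ 0` forces `V(α) ≠ 0`), except that `dim K` is computed EXACTLY from the long exact sequence of the
pair: `H_{N+2}(U_k(ℂ)) = 0` (`isZero_singularHomology_complexPointsCompl_fermat`), so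
`dim K + dim H_{N+2}(X(ℂ)) = dim Hᴺ(Z_k(ℂ)) = dim Hᴺ(Xᴺₘ(ℂ))` (`relativeSingularHomology.finrank_ker_map_add_finrank_eq`)
and (H2⁺) gives `dim K ≤ #{γ : Σ γⱼ = 0}`. [cite: Ran1980, §1 Prop. 1.7 (i)] [cite: Shioda1979HodgeFermat, §1]
[cite: Milnor1968, §9 Thm. 9.1] [cite: HatcherAT2002, Thm. 2.16] -/
theorem fermatEigenspace_ne_bot_of_bounds_add [NeZero m] (hN : 1 ≤ N) (k : Fin (N + 3))
    (H1 : ∀ β : Fin (N + 3) → ZMod m, β ≠ 0 → β k = 0 → fermatEigenspace m β (N + 1) = ⊥)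
    (H2 : Module.finrank ℂ (complexBetti (fermatHypersurface N m) N) ≤
      Fintype.card {t : {γ : Fin (N + 2) → ZMod m // ∀ j, γ j ≠ 0} // ∑ j, t.1 j = 0} +
        Module.finrank ℂ (singularHomology ℂ ℂ (ComplexPoints (fermatHypersurface (N + 1) m)) (N + 2)))
    {α : Fin (N + 3) → ZMod m} (hα : ∀ i, α i ≠ 0) (hαs : ∑ i, α i = 0) :
    fermatEigenspace m α (N + 1) ≠ ⊥ := by
  classical
  have hm : m ≠ 0 := NeZero.ne m
  have hm1 : 1 ≤ m := NeZero.one_le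
  -- the ambient closed oriented manifold `X(ℂ)` and the section `Z_k(ℂ)`
  have hX : IsSmoothProjective (N + 1) (fermatHypersurface (N + 1) m) :=
    isSmoothProjective_fermatHypersurface (by omega) hm1
  letI := hX.chartedSpace
  haveI := ComplexPoints.compactSpace_of_isSmoothProjective hX
  haveI := ComplexPoints.t2Space_of_isSmoothProjective hX
  obtain ⟨μ⟩ := ComplexPoints.isOrientableOver ℂ hX
  set Kset : Set (ComplexPoints (fermatHypersurface (N + 1) m)) :=
    {P | P.pt ∈ fermatCoordHyperplane (N + 1) m k} with hKset
  have hK : IsClosed Kset := isClosed_fermatSectionPoints hm k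
  obtain ⟨T⟩ := nonempty_retractionNhds_fermatSectionPoints (n := N) hm1 k
  obtain ⟨eK⟩ := nonempty_homeomorph_fermatSectionPoints (n := N) hm k
  -- the inclusion `i : U_k(ℂ) ↪ X(ℂ)`
  set incl : C(complexPointsCompl (fermatHypersurface (N + 1) m) (fermatCoordHyperplane (N + 1) m k),
      ComplexPoints (fermatHypersurface (N + 1) m)) := ⟨Subtype.val, continuous_subtype_val⟩ with hincl
  -- characters and Pham eigenvectors for every all-non-zero `γ`
  obtain ⟨e, heinj, hecomm⟩ := exists_joinMap_compl (N := N) hm k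
  have hψ : ∀ t : {γ : Fin (N + 2) → ZMod m // ∀ j, γ j ≠ 0},
      ∃ ψ : Torus (fun _ : Fin (N + 2) ↦ m) →* ℂˣ,
        ∀ u, ψ u = fermatCharacter m (Fin.insertNth k 0 t.1) (fermatGroupEquiv m (Fin.insertNth k 1 u)) :=
    fun t ↦ exists_torusCharacter_eq (n := N + 1) k _
  choose ψ hψ using hψ
  have hE : ∀ t : {γ : Fin (N + 2) → ZMod m // ∀ j, γ j ≠ 0},
      ∃ E : singularHomology ℂ ℂ
        (complexPointsCompl (fermatHypersurface (N + 1) m) (fermatCoordHyperplane (N + 1) m k)) (N + 1),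
        E ≠ 0 ∧ ∀ u, singularHomology.map ℂ ℂ
          (diagonalMapCompl k (fermatGroupEquiv m (Fin.insertNth k 1 u))) (N + 1) E = ((ψ t u : ℂˣ) : ℂ) • E :=
    fun t ↦ exists_chart_eigenvector k t.2 (hψ t) heinj hecomm
  choose E hE0 hE using hE
  -- distinct characters, hence linear independence
  have hψinj : Function.Injective ψ := by
    intro t t' h
    refine Subtype.ext (funext fun j ↦ ?_)
    have hj := apply_succAbove_eq_of_torusCharacter_eq k (hψ t) (hψ t') (fun u ↦ by rw [h]) j
    rwa [Fin.insertNth_apply_succAbove, Fin.insertNth_apply_succAbove] at hj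
  haveI : Fintype (Torus (fun _ : Fin (N + 2) ↦ m)) := Fintype.ofFinite _
  have hlin : LinearIndependent ℂ E :=
    linearIndependent_of_eigenvectors
      (fun u ↦ (singularHomology.map ℂ ℂ
        (diagonalMapCompl k (fermatGroupEquiv m (Fin.insertNth k 1 u))) (N + 1)).hom)
      hψinj hE0 (fun t u ↦ hE t u)
  -- the kernel of `i_*` and the eigenvectors with `Σ γ = 0`
  set K := LinearMap.ker (singularHomology.map ℂ ℂ incl (N + 1)).hom with hKdef
  set S₀ : Set {γ : Fin (N + 2) → ZMod m // ∀ j, γ j ≠ 0} := {t | ∑ j, t.1 j = 0} with hS₀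
  have hS₀K : ∀ t ∈ S₀, E t ∈ K := by
    intro t ht
    rw [hKdef, LinearMap.mem_ker]
    refine map_incl_eq_zero_of_forall_eigenspace_eq_bot k (hψ t) (hE t) fun β hβ ↦ ?_
    by_cases hs : ∑ i, β i = 0
    · -- `β_k = Σ β - Σ γ = 0`, `β ≠ 0`
      refine H1 β ?_ ?_
      · intro h0
        apply t.2 0
        simpa [h0] using (hβ 0).symm
      · rw [Fin.sum_univ_succAbove β k] at hs
        simp only [hβ] at hs
        change β k + ∑ j, t.1 j = 0 at hs
        rw [show (∑ j, t.1 j) = 0 from ht, add_zero] at hs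
        exact hs
    · exact fermatEigenspace_eq_bot_of_sum_ne_zero hs _
  have hspan : Submodule.span ℂ (E '' S₀) ≤ K :=
    Submodule.span_le.mpr (by rintro _ ⟨t, ht, rfl⟩; exact hS₀K t ht)
  -- `dim K + b_{N+2}(X) = dim Hᴺ(Z_k(ℂ)) = dim Hᴺ(Xᴺₘ(ℂ)) ≤ #S₀ + b_{N+2}(X)` (here is the sharpening)
  haveI := finite_complexBetti (isSmoothProjective_fermatHypersurface hN hm1) N
  haveI : Module.Finite ℂ (singularCohomology ℂ ℂ (↥Kset) N) :=
    Module.Finite.equiv (singularCohomology.mapIso ℂ ℂ eK N).toLinearEquiv.symm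
  have hU0 : IsZero (singularHomology ℂ ℂ (↥Ksetᶜ) (N + 1 + 1)) :=
    isZero_singularHomology_complexPointsCompl_fermat ℂ (n := N + 1) hm k (b := N + 1 + 1) (by omega) (by omega)
  obtain ⟨hKfg, hKeq⟩ := relativeSingularHomology.finrank_ker_map_add_finrank_eq μ hK T (p := N) (q := N + 1)
    (by ring) hU0
  have hKle' : Module.finrank ℂ K ≤ Fintype.card ↥S₀ := by
    have h1 : Module.finrank ℂ K + Module.finrank ℂ
        (singularHomology ℂ ℂ (ComplexPoints (fermatHypersurface (N + 1) m)) (N + 2)) =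
        Module.finrank ℂ (singularCohomology ℂ ℂ (↥Kset) N) := hKeq
    have heK : Module.finrank ℂ (singularCohomology ℂ ℂ (↥Kset) N) =
        Module.finrank ℂ (complexBetti (fermatHypersurface N m) N) :=
      (singularCohomology.mapIso ℂ ℂ eK N).toLinearEquiv.finrank_eq
    have hcard : Fintype.card {t : {γ : Fin (N + 2) → ZMod m // ∀ j, γ j ≠ 0} // ∑ j, t.1 j = 0} =
        Fintype.card ↥S₀ := Fintype.card_congr (Equiv.refl _)
    omega
  -- hence the `E_γ`, `Σ γ = 0`, span `K`
  have hrank : Module.finrank ℂ (Submodule.span ℂ (E '' S₀)) = Fintype.card ↥S₀ := by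
    rw [show E '' S₀ = Set.range (E ∘ ((↑) : ↥S₀ → _)) by
      rw [Set.range_comp, Subtype.range_coe]]
    exact finrank_span_eq_card (hlin.comp _ Subtype.val_injective)
  haveI : FiniteDimensional ℂ K := Module.Finite.iff_fg.mpr hKfg
  have heq : Submodule.span ℂ (E '' S₀) = K :=
    Submodule.eq_of_le_of_finrank_le hspan (by rw [hrank]; exact hKle')
  -- the eigenvector of `γ = (αᵢ)_{i ≠ k}` is not in `K`
  set t₁ : {γ : Fin (N + 2) → ZMod m // ∀ j, γ j ≠ 0} := ⟨fun j ↦ α (k.succAbove j), fun j ↦ hα _⟩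
    with ht₁def
  have ht₁ : t₁ ∉ S₀ := by
    intro h
    apply hα k
    have hsum := Fin.sum_univ_succAbove α k
    rw [hαs] at hsum
    change (0 : ZMod m) = α k + ∑ j, t₁.1 j at hsum
    rw [show (∑ j, t₁.1 j) = 0 from h, add_zero] at hsum
    exact hsum.symm
  have hnot : E t₁ ∉ K := by
    rw [← heq]
    exact hlin.notMem_span_image ht₁
  rw [hKdef, LinearMap.mem_ker] at hnot
  -- so `i_* E_{t₁} ≠ 0`: some `V(β)` with chart character `t₁` is non-zero, and it is `V(α)`
  intro hbot
  apply hnot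
  refine map_incl_eq_zero_of_forall_eigenspace_eq_bot k (hψ t₁) (hE t₁) fun β hβ ↦ ?_
  by_cases hs : ∑ i, β i = 0
  · -- `β = α`
    have hβα : β = α := by
      funext i
      refine Fin.succAboveCases k ?_ (fun j ↦ hβ j) i
      rw [Fin.sum_univ_succAbove β k] at hs
      have hs' := hαs
      rw [Fin.sum_univ_succAbove α k] at hs'
      simp only [hβ] at hs
      change β k + ∑ j, α (k.succAbove j) = 0 at hs
      have h3 : β k + ∑ j, α (k.succAbove j) = α k + ∑ j, α (k.succAbove j) := by rw [hs, hs']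
      exact add_right_cancel h3
    rw [hβα]
    exact hbot
  · exact fermatEigenspace_eq_bot_of_sum_ne_zero hs _

/-! ### The odd-dimensional Fermat variety -/

/-- **`b_{2p+2}(X²ᵖ⁺¹ₘ(ℂ); ℂ) ≥ 1` in homology** (`p, m ≥ 1`): over the field `ℂ` homological and cohomological
Betti numbers agree (`finrank_singularCohomology_eq_bettiNumber_of_field`), and `H²ᵖ⁺²(X(ℂ); ℂ) ∋ ι^*hᵖ⁺¹ ≠ 0`
(`exists_map_hypersurfaceι_ne_zero`: the degree of `X²ᵖ⁺¹ₘ ⊂ ℙ²ᵖ⁺²` is non-zero). [cite: HatcherAT2002, §3.1 Thm. 3.2]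
[cite: VoisinHodgeII2003, §1.2.3 Cor. 1.25] -/
theorem one_le_finrank_singularHomology_fermat_odd (hm : 1 ≤ m) {p : ℕ} (hp : 1 ≤ p) :
    1 ≤ Module.finrank ℂ (singularHomology ℂ ℂ (ComplexPoints (fermatHypersurface (2 * p + 1) m)) (2 * p + 2)) := by
  have hX : IsSmoothProjective (2 * p + 1) (fermatHypersurface (2 * p + 1) m) :=
    isSmoothProjective_fermatHypersurface (by omega) hm
  haveI := finite_complexBetti hX (2 * p + 2)
  have h1 : Module.finrank ℂ (singularHomology ℂ ℂ (ComplexPoints (fermatHypersurface (2 * p + 1) m)) (2 * p + 2)) =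
      Module.finrank ℂ (complexBetti (fermatHypersurface (2 * p + 1) m) (2 * p + 2)) := by
    change bettiNumber ℂ (ComplexPoints (fermatHypersurface (2 * p + 1) m)) (2 * p + 2) =
      Module.finrank ℂ (singularCohomology ℂ ℂ (ComplexPoints (fermatHypersurface (2 * p + 1) m)) (2 * p + 2))
    rw [finrank_singularCohomology_eq_bettiNumber_of_field]
  rw [h1, Nat.succ_le_iff, Module.finrank_pos_iff_exists_ne_zero]
  obtain ⟨γ, hγ⟩ := exists_map_hypersurfaceι_ne_zero (n := 2 * p) (m := m) (by omega) hm (p := p) (by omega)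
  exact ⟨_, hγ⟩

/-- **`V(α) ≠ 0` for every admissible character in the middle cohomology of the odd-dimensional Fermat variety**
(`p, m ≥ 1`): for `α = (α₀, …, α₂ₚ₊₂) ∈ (ℤ/m)²ᵖ⁺³` with all `αᵢ ≠ 0` and `Σ αᵢ = 0`, the eigenspace
`V(α) ⊆ H²ᵖ⁺¹(X²ᵖ⁺¹ₘ(ℂ); ℂ)` of `χ_α` is non-zero — the existence half of Shioda's "`dim V(α) = 1` for `α ∈ 𝔄ⁿₘ`"
for odd `n` (the bound `≤ 1` is the tree's `fermatEigenspace_le_span_odd`). From `fermatEigenspace_ne_bot_of_bounds_add`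
with the odd-dimensional vanishing `fermatEigenspace_eq_bot_odd_of_apply_eq_zero`, the even-dimensional count
`b₂ₚ(X²ᵖₘ) = |𝔄²ᵖₘ| + 1` for the section (`finrank_complexBetti_fermat_even_eq_card_add_one`) and `b₂ₚ₊₂(X²ᵖ⁺¹ₘ) ≥ 1`.
[cite: Shioda1979HodgeFermat, §1 (1.3)–(1.4)] [cite: Ran1980, §1 Prop. 1.7 (i)] -/
theorem fermatEigenspace_ne_bot_odd [NeZero m] {p : ℕ} (hp : 1 ≤ p) {α : Fin (2 * p + 3) → ZMod m}
    (hα : ∀ i, α i ≠ 0) (hαs : ∑ i, α i = 0) : fermatEigenspace m α (2 * p + 1) ≠ ⊥ := by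
  have hm1 : 1 ≤ m := NeZero.one_le
  have H1 : ∀ β : Fin (2 * p + 3) → ZMod m, β ≠ 0 → β 0 = 0 → fermatEigenspace m β (2 * p + 1) = ⊥ :=
    fun β _ hβ0 ↦ fermatEigenspace_eq_bot_odd_of_apply_eq_zero hm1 p hβ0
  have H2 : Module.finrank ℂ (complexBetti (fermatHypersurface (2 * p) m) (2 * p)) ≤
      Fintype.card {t : {γ : Fin (2 * p + 2) → ZMod m // ∀ j, γ j ≠ 0} // ∑ j, t.1 j = 0} +
        Module.finrank ℂ (singularHomology ℂ ℂ (ComplexPoints (fermatHypersurface (2 * p + 1) m)) (2 * p + 2)) := by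
    rw [finrank_complexBetti_fermat_even_eq_card_add_one (m := m) hp,
      Fintype.card_congr (Equiv.subtypeSubtypeEquivSubtypeInter
        (fun γ : Fin (2 * p + 2) → ZMod m ↦ ∀ j, γ j ≠ 0) (fun γ ↦ ∑ j, γ j = 0))]
    exact Nat.add_le_add_left (one_le_finrank_singularHomology_fermat_odd hm1 hp) _
  exact fermatEigenspace_ne_bot_of_bounds_add (N := 2 * p) (by omega) 0 H1 H2 hα hαs

end Literature.AlgebraicGeometry.HodgeTheory

end
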